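import Literature.AlgebraicGeometry.Motives.ChowFamilyFinite
import Literature.AlgebraicGeometry.Motives.CechComplexPseudoCoherentOfChow
import Literature.AlgebraicGeometry.Resolution.ChowLemmaRing
import Literature.AlgebraicGeometry.Motives.RatFnBirational
import HarnessLib

/-!
# Proof of `cechComplex_pseudoCoherent_general` (Görtz–Wedhorn II, Thm. 23.133 / Cor. 23.135 for
# the Čech complex of `𝒪(D)` on `X ×_K T → T`)

This file discharges the named fact `cechComplex_pseudoCoherent_general` of
`Motives/GrothendieckComplexSectionAlongCech` (`cechComplex_pseudoCoherent_general_holds`), closing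
the chain

* `Motives/CechComplexPseudoCoherentDescent` (Step (IV), noetherian approximation: it suffices that
  the Čech cohomology of `𝒪(D)` over affine integral noetherian bases be finitely generated),
* `Motives/CechCoherentDevissage` with `Motives/CoherentFracColon`/`Line`/`Piece` (Thm. 23.17 /
  Cor. 23.18 for coherent rank-one families by noetherian induction and dévissage, GIVEN Chow
  families) and `Motives/CechComplexPseudoCoherentOfChow` (the Čech cover of `𝒪(D)` is a coherent
  family),

by constructing the CHOW FAMILIES (`chowFamilies`, assertion (3) in the printed proof of
Görtz–Wedhorn II, Thm. 23.17, p. 425: "we may apply Chow's lemma … `𝓖 := π_*𝓛^{⊗n}` …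
`R^if_*𝓖 ≅ R^i(f ∘ π)_*𝓛^{⊗n}` is coherent by Theorem 23.1 (1)"): for `V` integral and proper over
the affine noetherian `Spec A`, Chow's lemma (`Resolution/ChowLemmaRing.chow_proper`, proved) gives
a projective `π : Z → V`, `Z ↪ 𝐏ⁿ_A` integral, birational (`RatFn.functionFieldMap_bijective_of_isIso_morphismRestrict`);
after twisting the coordinates (`Motives/ProjTwistDictionary`) the family
`𝓖_d = π_*𝒪_Z(dH) ⊆ 𝒦_V` is coherent (`Motives/ChowFamilyCoherent`), contains `1` (`d ≥ 0`), and
has finitely generated Čech cohomology for `d` beyond Serre's vanishing bounds on the finitely many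
`π⁻¹U_s` (`Motives/ChowFamilyFinite`, `Literature/Algebra/Homology/LaurentCechEvalSes`).

Everything is proved; no named facts are introduced; the statement of the fact is unchanged.

## References

* U. Görtz, T. Wedhorn, *Algebraic Geometry II: Cohomology of Schemes*, Springer Spektrum (2023),
  doi:10.1007/978-3-658-43031-3: Thm. 23.133 with proof Steps (I)–(IV), Cor. 23.135 (pp. 478–480);
  Thm. 23.17 with proof and Cor. 23.18 (pp. 424–425); Thm. 23.1 (p. 412); Thm. 22.9 (p. 332).
  [GortzWedhorn2023]
* U. Görtz, T. Wedhorn, *Algebraic Geometry I: Schemes*, 2nd ed. (2020): Thm. 13.100 (Chow's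
  lemma), Lemma 12.63. [GortzWedhorn2020]
* A. Grothendieck, EGA III₁, Thm. 3.2.1; The Stacks Project, Tags 02O5, 01YF. [StacksProject]
-/

noncomputable section

open CategoryTheory CategoryTheory.Limits AlgebraicGeometry TopologicalSpace Opposite
open Literature.Algebra.Homology Literature.Algebra.Homology.LaurentCech
open Literature.Algebra.Homology.OrderedCech
open Literature.AlgebraicGeometry.Morphisms Literature.AlgebraicGeometry.Morphisms.ProjCech
open Literature.AlgebraicGeometry.Motives.RatFn Literature.AlgebraicGeometry.Motives.ProjFrac
open Literature.AlgebraicGeometry.Motives.FracFamily Literature.AlgebraicGeometry.Motives.ProjTwist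

universe u

attribute [local instance] MvPolynomial.gradedAlgebra
  Literature.AlgebraicGeometry.Motives.ProjBaseChange.algebraBase

namespace Literature.AlgebraicGeometry.Motives

/-- **Chow families over a proper `V → Spec A`** (Görtz–Wedhorn II, proof of Thm. 23.17, assertion
(3)): for `V` integral and proper over `Spec A`, `A` noetherian acting on `K(V)` through the
structure morphism, and every finite cover `𝔘` of `V` with affine intersections, there is a coherent
rank-one family `𝓖 ⊆ 𝒦_V` on `𝔘` containing `1` all of whose Čech cohomology modules are finitely
generated over `A` — namely `𝓖 = π_*𝒪_Z(dH)` for a Chow cover `π : Z → V`, `Z ↪ 𝐏ⁿ_A`, and `d`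
large. [cite: GortzWedhorn2023, Thm. 23.17 proof, assertion (3) (p. 425), with Thm. 13.100 of GortzWedhorn2020 and Thm. 23.1 (p. 412)] -/
theorem ChowFamily.exists_coherent_finite {A : Type u} [CommRing A] [IsNoetherianRing A]
    {V : Scheme.{u}} [IsIntegral V] (q : V ⟶ Spec (.of A)) [IsProper q] [Algebra A V.functionField]
    (hAV : ∀ a : A, algebraMap A V.functionField a =
      ofSection (U := ⊤) (Set.mem_univ _) (q.appTop ((Scheme.ΓSpecIso (.of A)).inv a)))
    {κ : Type} [LinearOrder κ] [Fintype κ] (𝔘 : CoverData V κ) (h0 : 𝔘.U ∅ = ⊤) :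
    ∃ (G : Finset κ → Submodule A V.functionField) (hG : IsCoherent 𝔘 G),
      (∀ t, (1 : V.functionField) ∈ G t) ∧ ∀ i, Module.Finite A ((complex G hG.mono).homology i) := by
  classical
  haveI : IsLocallyNoetherian V := LocallyOfFiniteType.isLocallyNoetherian q
  -- Chow's lemma
  obtain ⟨n, Z, π, ιc, hint, hci, -, hsurj, hι, U, hU, hU', hiso⟩ :=
    Resolution.ChowLemmaRing.chow_proper V q
  haveI := hint
  haveI := hsurj
  haveI := hiso
  -- the closed immersion into `𝐏ⁿ_A` with its type spelled as `PP A n`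
  let ι' : Z ⟶ PP A n := ιc
  haveI : IsClosedImmersion ι' := hci
  have hι' : ι' ≫ toSpec A n = π ≫ q := hι
  have hbij : Function.Bijective (functionFieldMap π) :=
    functionFieldMap_bijective_of_isIso_morphismRestrict π U hU hU'
  letI : Algebra A Z.functionField :=
    ((functionFieldMap π).comp (algebraMap A V.functionField)).toAlgebra
  have hAZ : ∀ a : A, algebraMap A Z.functionField a =
      functionFieldMap π (algebraMap A V.functionField a) := fun _ => rfl
  -- a coordinate not vanishing on `Z` and the twist coefficients
  have hmem : ∀ H : MvPolynomial (Fin (n + 1)) A,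
      genericPoint Z ∈ ZH ι' H ↔ H ∉ (ι'.base (genericPoint Z)).asHomogeneousIdeal := fun _ => Iff.rfl
  obtain ⟨a₀, ha₀⟩ : ∃ a₀, genericPoint Z ∈ ZH ι' (MvPolynomial.X a₀) := by
    have hcov := Proj.iSup_basicOpen_eq_top (𝒜 := grading A n) (fun j => MvPolynomial.X j)
      (ProjBaseChangeRing.irrelevant_le_span_X A)
    have : ι'.base (genericPoint Z) ∈ (⨆ j, Proj.basicOpen (grading A n) (MvPolynomial.X j)) := by
      rw [hcov]; trivial
    obtain ⟨a₀, ha₀⟩ := Opens.mem_iSup.1 this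
    exact ⟨a₀, ha₀⟩
  set c : Fin (n + 1) → A := fun j => if genericPoint Z ∈ ZH ι' (MvPolynomial.X j) then 0 else 1
    with hcdef
  have hc : c a₀ = 0 := if_pos ha₀
  have hℓ : ∀ j, genericPoint Z ∈ ZH ι' (ell c a₀ j) := fun j => by
    by_cases h : genericPoint Z ∈ ZH ι' (MvPolynomial.X j)
    · have e : ell c a₀ j = MvPolynomial.X j := by
        rw [ell, hcdef]
        simp only [h, if_true, MvPolynomial.C_0, zero_mul, add_zero]
      rw [e]; exact h
    · have e : ell c a₀ j = MvPolynomial.X j + MvPolynomial.X a₀ := by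
        rw [ell, hcdef]
        simp only [h, if_false, MvPolynomial.C_1, one_mul]
      rw [e, hmem]
      rw [hmem, not_not] at h
      intro hsum
      have : (MvPolynomial.X a₀ : MvPolynomial (Fin (n + 1)) A) ∈
          (ι'.base (genericPoint Z)).asHomogeneousIdeal := by
        have := Ideal.sub_mem _ hsum h
        rwa [add_sub_cancel_left] at this
      exact (hmem _).1 ha₀ this
  -- Serre's vanishing bounds on the `π⁻¹U_s`
  have hex : ∀ s₁ : Finset κ, s₁.Nonempty → ∃ d₀ : ℤ, ∀ d, d₀ ≤ d →
      letI := secAlgebraZ π (𝔘.U s₁)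
      ∀ m : ℤ, 1 ≤ m → (evCplx Γ(V, 𝔘.U s₁) (theta ι' c a₀ ha₀) (isUnit_theta ι' c a₀ ha₀ hℓ)
        (fun _ : Unit => (1 : Z.functionField)) (0 : Unit → ℤ) d).ExactAt m := fun s₁ hs₁ => by
    letI := secAlgebraZ π (𝔘.U s₁)
    haveI : IsNoetherianRing Γ(V, 𝔘.U s₁) :=
      IsLocallyNoetherian.component_noetherian (⟨𝔘.U s₁, 𝔘.affine hs₁⟩ : V.affineOpens)
    exact exists_forall_exactAt_evCplx _ (theta ι' c a₀ ha₀) (isUnit_theta ι' c a₀ ha₀ hℓ) _ _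
  choose d₀ hd₀ using hex
  set dd : Finset κ → ℤ := fun s₁ => if h : s₁.Nonempty then |d₀ s₁ h| else 0 with hdddef
  have hdd0 : ∀ s₁, 0 ≤ dd s₁ := fun s₁ => by
    rw [hdddef]; dsimp only; split_ifs <;> simp
  set d : ℤ := ∑ s₁ : Finset κ, dd s₁ with hddef
  have hdnonneg : 0 ≤ d := Finset.sum_nonneg fun s₁ _ => hdd0 s₁
  have hdle : ∀ (s₁ : Finset κ) (h : s₁.Nonempty), d₀ s₁ h ≤ d := fun s₁ h => by
    have h1 : dd s₁ ≤ d := Finset.single_le_sum (fun s _ => hdd0 s) (Finset.mem_univ s₁)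
    have h2 : d₀ s₁ h ≤ dd s₁ := by
      rw [hdddef]; dsimp only; rw [dif_pos h]; exact le_abs_self _
    exact h2.trans h1
  refine ⟨ChowFamily.fam ι' c a₀ ha₀ q π hι' hAV hAZ hbij 𝔘 d,
    ChowFamily.isCoherent_fam ι' c a₀ hc ha₀ hℓ q π hι' hAV hAZ hbij 𝔘 d,
    fun t => ChowFamily.one_mem_fam ι' c a₀ ha₀ q π hι' hAV hAZ hbij 𝔘 hdnonneg t, fun i => ?_⟩
  exact ChowFamily.moduleFinite_homology_fam ι' c a₀ hc ha₀ hℓ q π hι' hAV hAZ hbij 𝔘 h0 d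
    (fun s₁ hs₁ => hd₀ s₁ hs₁ d (hdle s₁ hs₁)) i

/-- **Chow families in the shape consumed by `cechComplex_pseudoCoherent_general_of_chowFamilies`**
(affine noetherian `B`, proper `g₀ : Z₀ → B`, integral closed `ic : V ↪ Z₀`, `Γ(B, 𝒪_B)` acting on
`K(V)` through `V → Z₀ → B`): `V → B ≅ Spec Γ(B, 𝒪_B)` is proper, and
`ChowFamily.exists_coherent_finite` applies. [cite: GortzWedhorn2023, Thm. 23.17 proof (p. 425)] -/
theorem chowFamilies (B Z₀ : Scheme.{u}) (g₀ : Z₀ ⟶ B) [IsAffine B] [IsNoetherianRing Γ(B, ⊤)]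
    [IsProper g₀] (V : Scheme.{u}) [IsIntegral V] (ic : V ⟶ Z₀) [IsClosedImmersion ic]
    [Algebra Γ(B, ⊤) V.functionField] (hAlg : AlgCompat B Z₀ g₀ V ic)
    {ι : Type} [LinearOrder ι] [Fintype ι] (𝔘 : CoverData V ι) (h0 : 𝔘.U ∅ = ⊤) :
    ∃ (G : Finset ι → Submodule Γ(B, ⊤) V.functionField) (hG : IsCoherent 𝔘 G),
      (∀ t, (1 : V.functionField) ∈ G t) ∧
        ∀ i, Module.Finite Γ(B, ⊤) ((complex G hG.mono).homology i) := by
  let q : V ⟶ Spec (.of Γ(B, ⊤)) := (ic ≫ g₀) ≫ B.isoSpec.hom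
  haveI : IsProper q := inferInstance
  refine ChowFamily.exists_coherent_finite (A := Γ(B, ⊤)) q (fun a => ?_) 𝔘 h0
  have e1 : q.appTop ((Scheme.ΓSpecIso (.of Γ(B, ⊤))).inv a) = (ic ≫ g₀).appTop a := by
    change ((ic ≫ g₀) ≫ B.isoSpec.hom).appTop _ = _
    rw [Scheme.Hom.comp_appTop, CategoryTheory.ConcreteCategory.comp_apply, Scheme.isoSpec_hom,
      Scheme.toSpecΓ_appTop]
    exact congrArg _ ((Scheme.ΓSpecIso Γ(B, ⊤)).inv_hom_id_apply a)
  rw [e1]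
  exact hAlg a

/-- **Görtz–Wedhorn II, Thm. 23.133 / Cor. 23.135 for the Čech complex of `𝒪(D)` over an affine
open of the base of `pr_T : X ×_K T → T` — the named fact `cechComplex_pseudoCoherent_general`
holds.** Proof: `cechComplex_pseudoCoherent_general_of_chowFamilies` (noetherian approximation,
Step (IV); the dévissage of Thm. 23.17 / Cor. 23.18 for coherent rank-one families; the Čech cover
of `𝒪(D)` as a coherent family) and `chowFamilies` (Chow's lemma, Serre's theorems, Leray in Čech
form). [cite: GortzWedhorn2023, Thm. 23.133 with proof Steps (I)–(IV) and Cor. 23.135 (pp. 478–480); Thm. 23.17 with proof and Cor. 23.18 (pp. 424–425)] -/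
theorem cechComplex_pseudoCoherent_general_holds : cechComplex_pseudoCoherent_general := by
  refine cechComplex_pseudoCoherent_general_of_chowFamilies ?_
  intro B Z₀ g₀ _ _ _ V _ ic _ _ hAlg ι _ _ 𝔘 h0
  exact chowFamilies B Z₀ g₀ V ic hAlg 𝔘 h0

end Literature.AlgebraicGeometry.Motives

end
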